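import Mathlib
import Literature.Analysis.FluidPDE.EnergyToolkit
import Literature.Analysis.FluidPDE.TaoEnstrophyLocalisation
import Literature.Analysis.FluidPDE.AxisymQuotientRayAverage
import Summits.NavierStokesRegularity.NavierStokesRegularity.Theorems.TypeICertificateLadderRungReynoldsOneTaoCover
import HarnessLib

/-!
# Route `TautLoopKelvin`, crux `TautLoopLaw` (stmt-NavierStokesRegularity-15249),
  line `Sketch-ideas-r1k1` (Dini–Saks architecture) — tools stub `stub_tautLoopStepSlabDeluxeTools`

**Statement (deluxe slab bounds).** Let `ν, T > 0` and let `(u, p)` be a classical solution of the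
unforced Navier–Stokes system on `[0, T) × ℝ³` which is a Leray–Hopf solution on `[0, T)` from its
rapidly decaying datum `u 0`, and let `0 < a < b < T`. Then on the interior slab `[a, b]`

* (i) every spatial derivative `Dⁿu` is bounded: `‖Dⁿ(u s)(x)‖ ≤ Bₙ` for `s ∈ [a, b]`, all `x`;
* (ii) `u`, `Du`, `D²u` are Lipschitz in time in the sup norm with one constant `Bt`:
  `‖Dᵏu(s') x − Dᵏu(s) x‖ ≤ Bt |s' − s|` for `s, s' ∈ [a, b]`, all `x`, `k = 0, 1, 2`.

**Proof.** Put `T' = (b + T)/2 ∈ (b, T)`. By the Tao-class cover of closed sub-slabs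
(`RungReynoldsOne.stub_taoCover`: Tao 2013, Cor. 11.1 gives bounded Sobolev norms of `u` on
`[0, T']`, and the restart/uniqueness/gluing argument with Tao's local theorem, Thm. 5.4, puts `u`
in Tao's smooth `H¹` class there), `u` and its one-sided time derivative `∂ₜu`
(`timeDerivWithin (Icc 0 T') u`) have all spatial `L²` Sobolev norms bounded on `[0, T']`, and `u`
is a classical solution on the closed slab, hence jointly smooth there; so is `∂ₜu`
(`IsSmoothSpaceTimeOn.timeDerivWithin`). The Sobolev imbedding `H² ⊂ C_B` applied to `Dⁿu` and
`Dⁿ∂ₜu` (`HasBoundedSobolevNormsOn.exists_forall_norm_iteratedFDeriv_le`) gives (i) and sup bounds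
of `Dᵏ∂ₜu`, `k = 0, 1, 2`. For (ii): mixed partials of a jointly smooth field on an interval
commute, `∂ₜ Dᵏu = Dᵏ ∂ₜu` (`IsSmoothSpaceTimeOn.timeDerivWithin_fderiv_slice_apply`, iterated:
`tautLoopSlabD_timeDerivWithin_iteratedFDeriv_slice`), so the jointly smooth field
`(s, x) ↦ Dᵏ(u s)(x)` has time derivative bounded by `sup ‖Dᵏ∂ₜu‖`, and the mean value inequality
on the convex time set `[0, T']` (`Convex.norm_image_sub_le_of_norm_hasDerivWithin_le`) gives the
Lipschitz bounds.
-/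

noncomputable section

open Set MeasureTheory Filter Topology Function Metric Literature.Analysis.FluidPDE
open scoped ENNReal NNReal ContDiff

namespace Summit.NavierStokesRegularity.NavierStokesRegularity.Theorems

set_option linter.dupNamespace false

/-! ## Calculus of jointly smooth fields: time-Lipschitz bounds and `∂ₜ Dⁿ = Dⁿ ∂ₜ` -/

section Calculus

variable {X : Type*} [NormedAddCommGroup X] [NormedSpace ℝ X]
variable {F : Type*} [NormedAddCommGroup F] [NormedSpace ℝ F]

/-- **Mean value inequality in time.** A jointly smooth field on a convex time set of unique
differentiability whose one-sided time derivative is bounded by `B` moves by at most `B |s' - s|`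
between the times `s` and `s'`. [folklore] -/
theorem tautLoopSlabD_norm_sub_le_of_timeDerivWithin {S : Set ℝ} {w : ℝ → X → F}
    (hw : IsSmoothSpaceTimeOn S w) (hS : UniqueDiffOn ℝ S) (hc : Convex ℝ S) {B : ℝ}
    (hB : ∀ t ∈ S, ∀ x, ‖timeDerivWithin S w t x‖ ≤ B) {s s' : ℝ} (hs : s ∈ S)
    (hs' : s' ∈ S) (x : X) : ‖w s' x - w s x‖ ≤ B * |s' - s| := by
  have h := hc.norm_image_sub_le_of_norm_hasDerivWithin_le (f := fun τ => w τ x)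
    (fun t ht => hw.hasDerivWithinAt_timeDerivWithin hS ht x) (fun t ht => hB t ht x) hs hs'
  rwa [Real.norm_eq_abs] at h

/-- **`∂ₜ D = D ∂ₜ` at the level of the derivative maps**: for a jointly smooth field on a time
set of unique differentiability contained in the closure of its interior, the one-sided time
derivative of the slice-derivative field `(s, y) ↦ D(w s)(y)` is the slice derivative of the
time derivative (the applied version is the tree's
`IsSmoothSpaceTimeOn.timeDerivWithin_fderiv_slice_apply`; evaluation at a fixed vector commutes
with `derivWithin`). [folklore] -/
theorem tautLoopSlabD_timeDerivWithin_fderiv_slice {S : Set ℝ} {w : ℝ → X → F}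
    (hw : IsSmoothSpaceTimeOn S w) (hS : UniqueDiffOn ℝ S) (hcl : S ⊆ closure (interior S))
    {t : ℝ} (ht : t ∈ S) (x : X) :
    timeDerivWithin S (fun s y => fderiv ℝ (w s) y) t x = fderiv ℝ (timeDerivWithin S w t) x := by
  ext v
  rw [← hw.timeDerivWithin_fderiv_slice_apply hS hcl ht x v]
  simp only [timeDerivWithin_apply]
  have h1 : HasDerivWithinAt (fun s => fderiv ℝ (w s) x)
      (derivWithin (fun s => fderiv ℝ (w s) x) S t) S t :=
    ((hw.fderiv_slice hS).differentiableWithinAt_time ht x).hasDerivWithinAt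
  have h2 : HasDerivWithinAt (fun s => fderiv ℝ (w s) x v)
      (derivWithin (fun s => fderiv ℝ (w s) x) S t v) S t := by
    simpa using h1.clm_apply (hasDerivWithinAt_const t S v)
  exact (h2.derivWithin (hS t ht)).symm

/-- **`∂ₜ Dⁿ = Dⁿ ∂ₜ` for all orders**: for a jointly smooth field on a time set of unique
differentiability contained in the closure of its interior, the one-sided time derivative of the
field of `n`-th slice derivatives `(s, y) ↦ Dⁿ(w s)(y)` is `Dⁿ` of the time derivative
(induction on `n`, `Dⁿ⁺¹ = curry ∘ D ∘ Dⁿ`, using the first-order exchange and the commutation of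
`∂ₜ` with a fixed continuous linear map). [folklore] -/
theorem tautLoopSlabD_timeDerivWithin_iteratedFDeriv_slice {S : Set ℝ} {w : ℝ → X → F}
    (hw : IsSmoothSpaceTimeOn S w) (hS : UniqueDiffOn ℝ S) (hcl : S ⊆ closure (interior S))
    (n : ℕ) {t : ℝ} (ht : t ∈ S) (x : X) :
    timeDerivWithin S (fun s y => iteratedFDeriv ℝ n (w s) y) t x =
      iteratedFDeriv ℝ n (timeDerivWithin S w t) x := by
  induction n generalizing x with
  | zero =>
    have h0 : ∀ (g : X → F) (y : X), iteratedFDeriv ℝ 0 g y =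
        ((continuousMultilinearCurryFin0 ℝ X F).symm : F →L[ℝ] (X [×0]→L[ℝ] F)) (g y) :=
      fun g y => rfl
    simp only [h0]
    exact hw.timeDerivWithin_clm_comp hS _ ht x
  | succ n ih =>
    have hVn : IsSmoothSpaceTimeOn S (fun s y => iteratedFDeriv ℝ n (w s) y) :=
      hw.iteratedFDeriv_slice hS n
    have hsucc : ∀ (g : X → F) (y : X), iteratedFDeriv ℝ (n + 1) g y =
        ((continuousMultilinearCurryLeftEquiv ℝ (fun _ : Fin (n + 1) => X) F).symm :
          (X →L[ℝ] (X [×n]→L[ℝ] F)) →L[ℝ] (X [×(n + 1)]→L[ℝ] F))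
          (fderiv ℝ (fun z => iteratedFDeriv ℝ n g z) y) := fun g y => by
      rw [iteratedFDeriv_succ_eq_comp_left]
      rfl
    simp only [hsucc]
    rw [(hVn.fderiv_slice hS).timeDerivWithin_clm_comp hS _ ht x,
      tautLoopSlabD_timeDerivWithin_fderiv_slice hVn hS hcl ht x]
    congr 2
    funext y
    exact ih y

/-- **Time-Lipschitz bound for `Dⁿ` of a jointly smooth field on a closed time interval**: if
`‖Dⁿ(∂ₜw)(t)‖ ≤ B` on `[α, β] × X` (one-sided time derivative within `[α, β]`), then
`‖Dⁿ(w s')(x) − Dⁿ(w s)(x)‖ ≤ B |s' − s|` for all `s, s' ∈ [α, β]` and all `x` (exchange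
`∂ₜ Dⁿ = Dⁿ ∂ₜ` and the mean value inequality in time). [folklore] -/
theorem tautLoopSlabD_iteratedFDeriv_sub_le {α β : ℝ} (hαβ : α < β) {w : ℝ → X → F}
    (hw : IsSmoothSpaceTimeOn (Icc α β) w) (n : ℕ) {B : ℝ}
    (hB : ∀ t ∈ Icc α β, ∀ x, ‖iteratedFDeriv ℝ n (timeDerivWithin (Icc α β) w t) x‖ ≤ B)
    {s s' : ℝ} (hs : s ∈ Icc α β) (hs' : s' ∈ Icc α β) (x : X) :
    ‖iteratedFDeriv ℝ n (w s') x - iteratedFDeriv ℝ n (w s) x‖ ≤ B * |s' - s| := by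
  have hS : UniqueDiffOn ℝ (Icc α β) := uniqueDiffOn_Icc hαβ
  have hcl : Icc α β ⊆ closure (interior (Icc α β)) := by
    rw [interior_Icc, closure_Ioo hαβ.ne]
  exact tautLoopSlabD_norm_sub_le_of_timeDerivWithin (hw.iteratedFDeriv_slice hS n) hS
    (convex_Icc α β) (fun t ht y => by
      rw [tautLoopSlabD_timeDerivWithin_iteratedFDeriv_slice hw hS hcl n ht y]
      exact hB t ht y) hs hs' x

end Calculus

/-! ## The deluxe slab bounds for the crux class -/

/-- **Deluxe slab bounds.** For a classical solution of Navier–Stokes on `[0, T) × ℝ³`,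
Leray–Hopf from its rapidly decaying datum, and `0 < a < b < T`: (i) all spatial derivatives of
`u` are bounded on `[a, b] × ℝ³`; (ii) `u`, `Du`, `D²u` are Lipschitz in time on `[a, b]` in the
sup norm, with one constant. Proof: Tao-class cover of `[0, (b+T)/2]` (Tao 2013, Cor. 11.1 and
Thm. 5.4: bounded Sobolev norms of `u` and `∂ₜu`), Sobolev imbedding, `∂ₜ Dᵏ = Dᵏ ∂ₜ`, and the
mean value inequality in time. [folklore] -/
theorem tautLoopSlabD_bounds {ν T : ℝ} (hν : 0 < ν) (hT : 0 < T)
    {u : ℝ → EuclideanSpace ℝ (Fin 3) → EuclideanSpace ℝ (Fin 3)}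
    {p : ℝ → EuclideanSpace ℝ (Fin 3) → ℝ} (hcl : IsClassicalNSSolutionOn (Ico 0 T) ν 0 u p)
    (hLH : IsLerayHopfOn T ν 0 (u 0) u) (hdec : HasRapidSpatialDecay (u 0)) {a b : ℝ}
    (ha : 0 < a) (hab : a < b) (hbT : b < T) :
    (∀ n : ℕ, ∃ B : ℝ, 0 ≤ B ∧ ∀ s ∈ Icc a b, ∀ x, ‖iteratedFDeriv ℝ n (u s) x‖ ≤ B) ∧
    (∃ Bt : ℝ, 0 ≤ Bt ∧
      (∀ s ∈ Icc a b, ∀ s' ∈ Icc a b, ∀ x, ‖u s' x - u s x‖ ≤ Bt * |s' - s|) ∧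
      (∀ s ∈ Icc a b, ∀ s' ∈ Icc a b, ∀ x,
        ‖fderiv ℝ (u s') x - fderiv ℝ (u s) x‖ ≤ Bt * |s' - s|) ∧
      (∀ s ∈ Icc a b, ∀ s' ∈ Icc a b, ∀ x,
        ‖iteratedFDeriv ℝ 2 (u s') x - iteratedFDeriv ℝ 2 (u s) x‖ ≤ Bt * |s' - s|)) := by
  -- the closed slab `[0, T']`, `T' = (b + T)/2 ∈ (b, T)`
  set T' : ℝ := (b + T) / 2 with hT'def
  have hT'0 : 0 < T' := by rw [hT'def]; linarith
  have hT'T : T' < T := by rw [hT'def]; linarith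
  have hbT' : b < T' := by rw [hT'def]; linarith
  obtain ⟨q, hcl', hBu, hBt, -⟩ := RungReynoldsOne.stub_taoCover hν hT hcl hLH hdec ⟨hT'0, hT'T⟩
  have hS : UniqueDiffOn ℝ (Icc 0 T') := uniqueDiffOn_Icc hT'0
  have hcl0 : Icc 0 T' ⊆ closure (interior (Icc 0 T')) := by
    rw [interior_Icc, closure_Ioo hT'0.ne]
  have hsub : Icc a b ⊆ Icc 0 T' := fun s hs => ⟨ha.le.trans hs.1, hs.2.trans hbT'.le⟩
  have hsm : IsSmoothSpaceTimeOn (Icc 0 T') u := hcl'.smooth_velocity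
  have hsmt : IsSmoothSpaceTimeOn (Icc 0 T') (timeDerivWithin (Icc 0 T') u) :=
    hsm.timeDerivWithin hS
  -- sup bounds of `Dⁿ ∂ₜu` on `[0, T'] × ℝ³`
  have hDt : ∀ n : ℕ, ∃ B : ℝ, 0 ≤ B ∧ ∀ t ∈ Icc 0 T', ∀ x,
      ‖iteratedFDeriv ℝ n (timeDerivWithin (Icc 0 T') u t) x‖ ≤ B := fun n =>
    hBt.exists_forall_norm_iteratedFDeriv_le (fun t ht => hsmt.contDiff_slice ht) n
  refine ⟨fun n => ?_, ?_⟩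
  · obtain ⟨B, hB0, hB⟩ :=
      hBu.exists_forall_norm_iteratedFDeriv_le (fun t ht => hcl'.contDiff_velocity ht) n
    exact ⟨B, hB0, fun s hs x => hB s (hsub hs) x⟩
  · obtain ⟨B₀, hB₀0, hB₀⟩ := hDt 0
    obtain ⟨B₁, hB₁0, hB₁⟩ := hDt 1
    obtain ⟨B₂, hB₂0, hB₂⟩ := hDt 2
    refine ⟨max B₀ (max B₁ B₂), le_max_of_le_left hB₀0, fun s hs s' hs' x => ?_,
      fun s hs s' hs' x => ?_, fun s hs s' hs' x => ?_⟩
    · -- `k = 0`: mean value inequality for `u` itself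
      have hb : ∀ t ∈ Icc 0 T', ∀ y, ‖timeDerivWithin (Icc 0 T') u t y‖ ≤ B₀ := fun t ht y => by
        have h := hB₀ t ht y
        rwa [norm_iteratedFDeriv_zero] at h
      have h := tautLoopSlabD_norm_sub_le_of_timeDerivWithin hsm hS (convex_Icc 0 T') hb
        (hsub hs) (hsub hs') x
      exact h.trans (mul_le_mul_of_nonneg_right (le_max_left _ _) (abs_nonneg _))
    · -- `k = 1`: mean value inequality for the field `(s, y) ↦ D(u s)(y)`
      have hb : ∀ t ∈ Icc 0 T', ∀ y,
          ‖timeDerivWithin (Icc 0 T') (fun s z => fderiv ℝ (u s) z) t y‖ ≤ B₁ := fun t ht y => by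
        rw [tautLoopSlabD_timeDerivWithin_fderiv_slice hsm hS hcl0 ht y,
          ← norm_iteratedFDeriv_one (timeDerivWithin (Icc 0 T') u t)]
        exact hB₁ t ht y
      have h := tautLoopSlabD_norm_sub_le_of_timeDerivWithin (hsm.fderiv_slice hS) hS
        (convex_Icc 0 T') hb (hsub hs) (hsub hs') x
      exact h.trans (mul_le_mul_of_nonneg_right ((le_max_left _ _).trans (le_max_right _ _))
        (abs_nonneg _))
    · -- `k = 2`
      have h := tautLoopSlabD_iteratedFDeriv_sub_le hT'0 hsm 2 hB₂ (hsub hs) (hsub hs') x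
      exact h.trans (mul_le_mul_of_nonneg_right ((le_max_right _ _).trans (le_max_right _ _))
        (abs_nonneg _))

/-- **Tools stub `stub_tautLoopStepSlabDeluxeTools`** (line `Sketch-ideas-r1k1`, serving stubs
6A/6B): for a classical solution of the unforced Navier–Stokes system on `[0, T) × ℝ³` which is
Leray–Hopf from its rapidly decaying datum, on every interior slab `[a, b] ⊂ (0, T)` all spatial
derivatives of `u` are bounded and `u`, `Du`, `D²u` are Lipschitz in time in the sup norm
(Tao 2013, Cor. 11.1 / Thm. 5.4 via the Tao-class cover; Sobolev imbedding; `∂ₜ Dᵏ = Dᵏ ∂ₜ`;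
mean value inequality). [folklore] -/
theorem stub_tautLoopStepSlabDeluxeTools : ∀ (ν T : ℝ), 0 < ν → 0 < T →
    ∀ (u : ℝ → EuclideanSpace ℝ (Fin 3) → EuclideanSpace ℝ (Fin 3))
      (p : ℝ → EuclideanSpace ℝ (Fin 3) → ℝ),
      Literature.Analysis.FluidPDE.IsClassicalNSSolutionOn (Set.Ico 0 T) ν 0 u p →
      Literature.Analysis.FluidPDE.IsLerayHopfOn T ν 0 (u 0) u →
      Literature.Analysis.FluidPDE.HasRapidSpatialDecay (u 0) →
      ∀ a b : ℝ, 0 < a → a < b → b < T →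
        (∀ n : ℕ, ∃ B : ℝ, 0 ≤ B ∧ ∀ s ∈ Set.Icc a b, ∀ x, ‖iteratedFDeriv ℝ n (u s) x‖ ≤ B) ∧
        (∃ Bt : ℝ, 0 ≤ Bt ∧
          (∀ s ∈ Set.Icc a b, ∀ s' ∈ Set.Icc a b, ∀ x, ‖u s' x - u s x‖ ≤ Bt * |s' - s|) ∧
          (∀ s ∈ Set.Icc a b, ∀ s' ∈ Set.Icc a b, ∀ x,
            ‖fderiv ℝ (u s') x - fderiv ℝ (u s) x‖ ≤ Bt * |s' - s|) ∧
          (∀ s ∈ Set.Icc a b, ∀ s' ∈ Set.Icc a b, ∀ x,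
            ‖iteratedFDeriv ℝ 2 (u s') x - iteratedFDeriv ℝ 2 (u s) x‖ ≤ Bt * |s' - s|)) := by
  intro ν T hν hT u p hcl hLH hdec a b ha hab hbT
  exact tautLoopSlabD_bounds hν hT hcl hLH hdec ha hab hbT

end Summit.NavierStokesRegularity.NavierStokesRegularity.Theorems

end
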